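import Mathlib
import Summits.Ventures.PercRepro.TriangleCapMaxDegree
import Summits.Ventures.PercRepro.TriangleCapDenseStabilityEight
import Summits.Ventures.PercRepro.TriangleCapFourBelowResidueF
import Summits.Ventures.PercRepro.TriangleCapFourBelowTwelveD
import Summits.Ventures.PercRepro.TriangleCapFourBelowTwelveE

/-!
# PercRepro — THE ROW `a = 4` OF THE CLOSED FORM: THE BASE ROWS `r = 1, 2, 3, 4` ON EVERY VERTEX TYPE FROM `k = 12`
(p3, gen 40; part 155)

The sub-diagonals `r ≤ 4` of the row `a = 4` (`m = 4 (k − 4) − r`), landed in gens 34–39 with bipartition /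
product hypotheses, restated uniformly: `four_row_base (r) (hr1 : 1 ≤ r) (hr4 : r ≤ 4) (hk : 12 ≤ k)
(hm : m + 16 + r = 4k) : Σ_v d(v)² + r (k − 1 − r) ≤ m k` — the base of the induction of part 157. The `r = 4`
row at `k = 12` is the cell `(12, 28)` on every vertex type (the `k ≥ 12` assembly of part 140 with the `a = 4`
residue of part 141 through the largest private set); the bipartition hypotheses are discharged by the products
`4 (k − 4) − 4 … − 1` (`products_avoid k 4`). Axioms: standard.
-/

namespace PercRepro

namespace TriangleCap

namespace C047

open Finset

variable {V : Type*} [Fintype V] [DecidableEq V]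

/-- No bipartition with `≤ N` missing pairs on the row `a = 4` (`k ≥ 12`, `m + N + 17 = 4k`, `N ≤ 3`). -/
theorem not_bip_of_four_row (D : SimpleGraph V) [DecidableRel D.Adj] (hk : 12 ≤ Fintype.card V) (N : ℕ)
    (hN : N ≤ 3) (hm : D.edgeFinset.card + N + 17 = 4 * Fintype.card V) :
    ¬ ∃ A : Finset V, (∀ x y, D.Adj x y → (x ∈ A ↔ y ∉ A)) ∧ (missing D A Aᶜ).card ≤ N := by
  rintro ⟨A, hA, hN'⟩
  have hNX := card_missing_add_card_edges D A hA
  have hXc : Aᶜ.card = Fintype.card V - A.card := by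
    have := card_add_card_compl A
    omega
  have hXk : A.card ≤ Fintype.card V := card_le_univ A
  rw [hXc] at hNX
  obtain ⟨h1, h2, h3, h4⟩ := products_avoid (Fintype.card V) 4 (by norm_num) (by omega) A.card hXk
  have e1 : 4 * (Fintype.card V - 4) - 4 = 4 * Fintype.card V - 20 := by omega
  have e2 : 4 * (Fintype.card V - 4) - 3 = 4 * Fintype.card V - 19 := by omega
  have e3 : 4 * (Fintype.card V - 4) - 2 = 4 * Fintype.card V - 18 := by omega
  have e4 : 4 * (Fintype.card V - 4) - 1 = 4 * Fintype.card V - 17 := by omega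
  rw [e1] at h1
  rw [e2] at h2
  rw [e3] at h3
  rw [e4] at h4
  have : (missing D A Aᶜ).card + D.edgeFinset.card = 4 * Fintype.card V - 20 ∨
      (missing D A Aᶜ).card + D.edgeFinset.card = 4 * Fintype.card V - 19 ∨
      (missing D A Aᶜ).card + D.edgeFinset.card = 4 * Fintype.card V - 18 ∨
      (missing D A Aᶜ).card + D.edgeFinset.card = 4 * Fintype.card V - 17 := by omega
  rcases this with h | h | h | h
  · exact h1 (by omega)
  · exact h2 (by omega)
  · exact h3 (by omega)
  · exact h4 (by omega)

omit [DecidableEq V] in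
/-- The product hypothesis of the `r = 4` row of `a = 4` (`m + 20 = 4k`, `k ≥ 12`). -/
theorem hprod_of_four_row (D : SimpleGraph V) [DecidableRel D.Adj] (hk : 12 ≤ Fintype.card V)
    (hm : D.edgeFinset.card + 20 = 4 * Fintype.card V) :
    ∀ a', a' ≤ Fintype.card V → D.edgeFinset.card ≠ a' * (Fintype.card V - a') ∧
      D.edgeFinset.card + 1 ≠ a' * (Fintype.card V - a') ∧ D.edgeFinset.card + 2 ≠ a' * (Fintype.card V - a') ∧
      D.edgeFinset.card + 3 ≠ a' * (Fintype.card V - a') := by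
  intro a' ha'
  have h := products_avoid (Fintype.card V) 4 (by norm_num) (by omega) a' ha'
  have e1 : 4 * (Fintype.card V - 4) - 4 = D.edgeFinset.card := by omega
  have e2 : 4 * (Fintype.card V - 4) - 3 = D.edgeFinset.card + 1 := by omega
  have e3 : 4 * (Fintype.card V - 4) - 2 = D.edgeFinset.card + 2 := by omega
  have e4 : 4 * (Fintype.card V - 4) - 1 = D.edgeFinset.card + 3 := by omega
  rw [e1, e2, e3, e4] at h
  exact h

/-- **THE ROW `r = 1` OF `a = 4`** (`m = 4k − 17`), `k ≥ 12`: `Σ_v d(v)² + (k − 2) ≤ m k`. -/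
theorem four_row_one (D : SimpleGraph V) [DecidableRel D.Adj] (hK : K4mFree D) (hk : 12 ≤ Fintype.card V)
    (hm : D.edgeFinset.card + 17 = 4 * Fintype.card V) :
    ∑ v, deg D v * deg D v + (Fintype.card V - 2) ≤ D.edgeFinset.card * Fintype.card V := by
  apply dense_stability_eight D hK (by omega) (by omega)
  rintro ⟨A, hA⟩
  have h := card_edges_eq_of_complete_bipartite D A hA
  have hXk : A.card ≤ Fintype.card V := card_le_univ A
  have h4 := (products_avoid (Fintype.card V) 4 (by norm_num) (by omega) A.card hXk).2.2.2
  have e4 : 4 * (Fintype.card V - 4) - 1 = D.edgeFinset.card := by omega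
  rw [e4] at h4
  exact h4 h

/-- **THE ROW `r = 4` OF `a = 4` AT `k = 12`:** the cell `(12, 28)` on every vertex type. -/
theorem four_row_four_twelve (D : SimpleGraph V) [DecidableRel D.Adj] (hK : K4mFree D)
    (hk : Fintype.card V = 12) (hm : D.edgeFinset.card = 28) :
    ∑ v, deg D v * deg D v + 4 * (Fintype.card V - 5) ≤ D.edgeFinset.card * Fintype.card V := by
  apply dense_stability_four_modulo_few_outer_twelve D hK (by omega) (by omega)
    (hprod_of_four_row D (by omega) (by omega))
  intro u v w huv huw hvw hT hdeg hpay _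
  exact residue_of_largest D 1
    (fun u v w huv huw hvw hT hmv hmw hq =>
      one_triangle_residue_four_twelve D hK huv huw hvw hT (by omega) hdeg hmv hmw (by omega) hq)
    huv huw hvw hT (by omega)

/-- **THE BASE ROWS `r = 1, 2, 3, 4` OF `a = 4`** from `k = 12`: `m + 16 + r = 4k` ⇒
`Σ_v d(v)² + r (k − 1 − r) ≤ m k`. -/
theorem four_row_base (D : SimpleGraph V) [DecidableRel D.Adj] (hK : K4mFree D) (r : ℕ) (hr1 : 1 ≤ r)
    (hr4 : r ≤ 4) (hk : 12 ≤ Fintype.card V) (hm : D.edgeFinset.card + 16 + r = 4 * Fintype.card V) :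
    ∑ v, deg D v * deg D v + r * (Fintype.card V - 1 - r) ≤ D.edgeFinset.card * Fintype.card V := by
  interval_cases r
  · have := four_row_one D hK hk (by omega)
    have e : Fintype.card V - 1 - 1 = Fintype.card V - 2 := by omega
    rw [e]
    omega
  · have := dense_stability_two_of_ten D hK (by omega) (by omega)
      (not_bip_of_four_row D hk 1 (by norm_num) (by omega))
    have e : Fintype.card V - 1 - 2 = Fintype.card V - 3 := by omega
    rw [e]
    exact this
  · have := dense_stability_three_of_ten D hK (by omega) (by omega) (by omega) (Or.inl (by omega))
      (not_bip_of_four_row D hk 2 (by norm_num) (by omega))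
    have e : Fintype.card V - 1 - 3 = Fintype.card V - 4 := by omega
    rw [e]
    exact this
  · have e : Fintype.card V - 1 - 4 = Fintype.card V - 5 := by omega
    rw [e]
    rcases Nat.lt_or_ge (Fintype.card V) 13 with h12 | h13
    · exact four_row_four_twelve D hK (by omega) (by omega)
    · exact dense_stability_four_four D hK h13 (by omega) (hprod_of_four_row D hk (by omega))

end C047

end TriangleCap

end PercRepro
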